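import Literature.AlgebraicGeometry.ShimuraVarieties.KudlaRapoport2013.Sec3ComplexUniformization
import Literature.NumberTheory.QuadraticForms.HilbertSymbol
import Mathlib.NumberTheory.Padics.PadicNumbers
import Mathlib.FieldTheory.Galois.Basic
import HarnessLib

/-!
# Kudla–Rapoport, *Special cycles on unitary Shimura varieties II: global theory*, §1 «Notation and conventions»
# (arXiv v2 pp. 6–7) — the standing notation of the paper, typed REAL in coordinates (squad TKR, row TKR-t03)

[KudlaRapoport2013] = S. Kudla, M. Rapoport, J. reine angew. Math. **697** (2014) 91–157 = arXiv:0912.3758; VERSION OF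
RECORD arXiv **v2** (squad ruling R-1), read on the squad's page-faithful extraction `T/KR/TKR-t02/g0/KR2013-arXivv2-pages.txt`
(sha16 5ca9342435eb98df) pp. 6–7, formulas re-derived from the held TeX of v1 (`paper:arxiv-0912.3758`, chunk p0005:
«Notation and conventions»).  CONCORDANCE v1 ↔ v2: identical text; displays **(1.2)** (product formula) and **(1.3)** (hermitian
form from the alternating form); v1 pp. 5–6, v2 pp. 6–7.  The INDEX of the introduction proper (Theorem 1.1, display (1.1)) is
the squad's companion file `KudlaRapoport2013/Sec1Introduction.lean` (row TKR-t02); this file types ONLY the «Notation and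
conventions» paragraph, which no section carpet restates.

## What this file is

The standing notation / conventions of pp. 6–7, typed REAL in the coordinates of the §3 file (READING R0 of ★
`Sec3ComplexUniformization`: `V = kⁿ` with a Gram matrix `J`, KR's form `( , ) = krForm σ J`, linear in the first and
`σ`-antilinear in the second variable — «we take `( , )` to be conjugate linear in the second argument», p. 6), over the tree's
★ `QuadraticForms.hilbertSymbol` and Mathlib's `ℚ_[p]`, `Algebra.trace`, `NumberField.discr`.  Squad rulings: R-9a (a row provable
from the tree in ≤ 15 lines is a `theorem` — two here), R-10 (remarks are not facts).  ONE named fact (CLOSED, hypotheses complete):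
`KR2013_1_selfDual_iff` («an `O_k`-lattice is self-dual for `( , )` iff it is self-dual for `⟨ , ⟩`», p. 7).  Dedup census
(2026-09-02): `rg 'tr\(\(x, ?y\)|tracePairing|inv_p|hilbertSymbol' Literature/AlgebraicGeometry/ShimuraVarieties` — the Hilbert-symbol
invariant `inv_p` is a ⟨CARRIER⟩ `Sec2Core.locInv` in ★ `Sec2Defs` (made REAL here as `invAt`; RSZ's analogue ★
`RapoportSmithlingZhang2020.Sec5GlobalIntegralModels.hermIsSplitAt` is the norm-class formulation over a general CM extension), and
(1.3) is quoted, not typed, in ★ `Sec2Defs.SelfDualLattice` / `Sec2Core.tateFormWeil`.  No `sorry`, no `axiom`, no `instance`, no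
`notation`.

## INDEX — «Notation and conventions» (v2 pp. 6–7) ↦ declaration (★ = landed elsewhere)

* p. 6 `k = ℚ(√Δ)` with discriminant `Δ` ↦ `Δ = NumberField.discr k` (Mathlib; as in ★ `Sec2Defs.IsRamifiedPrime`, ★
  `Sec13LevelStructures.absDisc`); `√Δ` with «we require that `τ(√Δ)` have positive imaginary part» ↦ `IsSqrtDisc`, `sqrtDisc`;
  `a ↦ a^σ` ↦ ★ `Liu2021.AppendixC.conj ℚ k`; `h_k` ↦ Mathlib `NumberField.classNumber k`; `w_k = |O_k^×|` ↦ Mathlib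
  `NumberField.Units.torsionOrder k` (both as used by ★ `Sec11Sec12MainTheorem.Sec11Data.C1`); `O_{k,p} = O_k ⊗ ℤ_p`,
  `O_{k,(p)} = O_k ⊗ ℤ_{(p)}` ↦ RECORDED (the §5, §11, §13 carpets localise where needed).
* p. 6 `det(V) ∈ ℚ^×/N(k^×)` ↦ `ratDet`, `SameNormClass`; `sig(V) = (r, s)` ↦ ★ `Sec3ComplexUniformization.HasSignatureAt` (and ★
  `HermSpace.sig`); **`inv_p(V) = χ_p(det V)`, `χ_p(a) = (a, Δ)_p`** ↦ `invAt`; «`inv_∞(V) = (−1)^s`», «`inv_p(V) = 1` for all split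
  `p`», «the isometry class of `V_p` is determined by `inv_p(V_p)` (resp. `sig(V_∞)`)» ↦ RECORDED in the docstring of `invAt`;
  «the isometry class of `V` over `k` is determined by the collection of its local invariants (Hasse principle)» ↦ ★ PROVED in
  the tree in Landherr's global form `Literature.NumberTheory.QuadraticForms.hermitianMatrices_congruent_iff_invariants` (two
  `σ`-hermitian matrices over a CM field are congruent iff they have the same positive index at every complex embedding and the
  same determinant class modulo norms) — not restated; **(1.2)** «`∏_{p ≤ ∞} inv_p(V_p) = 1`» + «Landherr's Theorem» (existence
  and uniqueness of a global space with prescribed local completions) ↦ RECORDED: for a GLOBAL `V` the product formula is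
  Hilbert reciprocity for `(det V, Δ)` = ★ the named fact `QuadraticForms.hilbertReciprocity`; the existence half of Landherr's
  theorem is not in the tree and is not typed here (KR use it only through Lemma 2.11, ★ `Sec2GlobalModuliProblem.Lemma211_i/ii`).
* p. 7 **`⟨x, y⟩ = tr((x, y)/√Δ)`** ↦ `tracePairing`; «`⟨a x, y⟩ = ⟨x, a^σ y⟩`» ↦ `tracePairing_smul_left` (THEOREM); **(1.3)**
  «`2(x, y) = ⟨√Δ x, y⟩ + ⟨x, y⟩ √Δ`» ↦ `two_mul_krForm_eq_tracePairing` (THEOREM; it needs only `(√Δ)^σ = −√Δ ≠ 0`); «conversely an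
  alternating `ℚ`-form with `⟨a x, y⟩ = ⟨x, a^σ y⟩` defines a hermitian form by (1.3)» ↦ RECORDED (the converse construction is not
  used later in the paper); **«an `O_k`-lattice in `V` is self-dual for `( , )` iff it is self-dual for `⟨ , ⟩`»** ↦
  `IsSelfDualForTrace` + the CLOSED fact `KR2013_1_selfDual_iff` (the two duals even coincide, because the different of the
  quadratic field `k` is the principal ideal `(√Δ)`; not provable in a few lines from the tree — Mathlib has `differentIdeal` but
  not its value for quadratic fields).

## References

* [KudlaRapoport2013] S. Kudla, M. Rapoport, *Special cycles on unitary Shimura varieties II: global theory*, J. reine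
  angew. Math. 697 (2014) 91–157; arXiv:0912.3758v2, §1 pp. 1–7.
* [Landherr1936HermitianForms] W. Landherr, *Äquivalenz Hermitescher Formen über einem beliebigen algebraischen Zahlkörper*,
  Abh. Math. Sem. Hamburg 11 (1936) 245–248 (KR's «Landherr's Theorem», p. 7; ★ `LandherrHermitianMatrices`).
* [Omeara1963] O. T. O'Meara, *Introduction to quadratic forms* (1963), §63B (the Hilbert symbol; ★ `QuadraticForms.HilbertSymbol`).
-/

noncomputable section

open NumberField Matrix
open Literature.NumberTheory.Automorphic.Liu2021.AppendixC (conj complexEmbedding_conj conj_ne_one)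
open Literature.AlgebraicGeometry.ShimuraVarieties.KudlaRapoport2013.Sec3ComplexUniformization (krForm IsSelfDualFor)
open Literature.NumberTheory.QuadraticForms (hilbertSymbol)

namespace Literature.AlgebraicGeometry.ShimuraVarieties.KudlaRapoport2013.Sec1NotationConventions

variable {k : Type} [Field k] [NumberField k] [IsTotallyComplex k] [Algebra.IsQuadraticExtension ℚ k]

/-! ## «Notation and conventions» (arXiv v2 pp. 6–7): `√Δ`, `det(V)`, `inv_p(V)` -/

/-- **`δ = √Δ ∈ k`, normalised by the complex embedding `τ`** (p. 6: «We fix an imaginary quadratic field `k = ℚ(√Δ)` with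
discriminant `Δ` … We view `k` as a subfield of `ℂ` via an embedding `τ` and require that `τ(√Δ)` have positive imaginary
part»; §3 p. 15: «`√Δ ∈ k` is the element for which `τ(√Δ)` has positive imaginary part»): `δ² = Δ = NumberField.discr k` and
`Im τ(δ) > 0`.  REAL. [cite: KudlaRapoport2013, §1 Notation and conventions (arXiv v2 p. 6)] -/
def IsSqrtDisc (τ : k →+* ℂ) (δ : k) : Prop :=
  δ ^ 2 = ((NumberField.discr k : ℤ) : k) ∧ 0 < (τ δ).im

/-- **The element `√Δ` of `k`** for the embedding `τ` (p. 6): the `δ` with `IsSqrtDisc τ δ` (it exists and is unique, `k` being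
`ℚ(√Δ)`; chosen by `Classical.epsilon`, junk if none existed). REAL. [cite: KudlaRapoport2013, §1 Notation and conventions (arXiv v2 p. 6)] -/
def sqrtDisc (τ : k →+* ℂ) : k :=
  @Classical.epsilon k ⟨0⟩ (IsSqrtDisc τ)

/-- **`det(V)`** (p. 6: «let `det(V) ∈ ℚ^×/N(k^×)` be the determinant of the matrix `((v_i, v_j))` where `{v_i}` is a `k`-basis
for `V`»), in coordinates (R0, Gram matrix `J` with `J i j = (e_j, e_i)`): the RATIONAL number `det J` (for `σ`-hermitian `J`,
`σ(det J) = det Jᵀ = det J` lies in `ℚ`; chosen by `Classical.epsilon`, junk `ℚ`-value when `det J ∉ ℚ`).  Its class modulo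
`N(k^×)` is `SameNormClass`. REAL. [cite: KudlaRapoport2013, §1 Notation and conventions (arXiv v2 p. 6)] -/
def ratDet {n : ℕ} (J : Matrix (Fin n) (Fin n) k) : ℚ :=
  Classical.epsilon fun a : ℚ => algebraMap ℚ k a = J.det

/-- **Equality in `ℚ^×/N(k^×)`** (p. 6): `a ≡ b` iff `a = b · z z^σ` for some `z ∈ k^×` (the determinant CLASS `det(V)`; cf. the
norm clause of ★ `QuadraticForms.hermitianMatrices_congruent_iff_invariants`). REAL. [cite: KudlaRapoport2013, §1 Notation and conventions (arXiv v2 p. 6)] -/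
def SameNormClass (a b : ℚ) : Prop :=
  ∃ z : k, z ≠ 0 ∧ algebraMap ℚ k a = algebraMap ℚ k b * (z * conj ℚ k z)

/-- **`inv_p(V) = χ_p(det(V))`, `χ_p(a) = (a, Δ)_p`** (p. 6: «Here `( , )_p` is the quadratic Hilbert symbol for `ℚ_p`»), for the
hermitian space `kⁿ` with Gram matrix `J` and a rational prime `p`: the tree's ★ `QuadraticForms.hilbertSymbol` over Mathlib's
`ℚ_[p]` at `(det J, Δ)`, `Δ = NumberField.discr k`; values in `{1, −1}`.  RECORDED (same page, not typed): «`inv_∞(V) = (−1)^s`»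
for `sig(V) = (r, s)` (★ `Sec3ComplexUniformization.HasSignatureAt τ J s`); «`inv_p(V) = 1` for all split primes `p`» (`Δ` is a
square in `ℚ_p`); «the isometry class of `V_p` over `k_p` (resp. `V_∞` over `ℂ`) is determined by `inv_p(V_p)` (resp. `sig(V_∞)`)»;
«the isometry class of `V` over `k` is determined by the collection of its local invariants (Hasse principle)» — ★ PROVED in the
tree as `QuadraticForms.hermitianMatrices_congruent_iff_invariants` (Landherr); **(1.2)** «for any collection of local hermitian
spaces `{V_p}` satisfying the product formula `∏_{p ≤ ∞} inv_p(V_p) = 1` there is a unique global hermitian space with the `V_p`'s as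
its local completions (Landherr's Theorem)» — for a global `V` the product formula is Hilbert reciprocity for `(det V, Δ)`, the
tree's named fact ★ `QuadraticForms.hilbertReciprocity`. REAL. [cite: KudlaRapoport2013, §1 Notation and conventions (1.2) (arXiv v2 pp. 6–7)] -/
def invAt (p : ℕ) [Fact p.Prime] {n : ℕ} (J : Matrix (Fin n) (Fin n) k) : ℤ :=
  hilbertSymbol ℚ_[p] ((ratDet J : ℚ) : ℚ_[p]) ((NumberField.discr k : ℤ) : ℚ_[p])

/-! ## The alternating form `⟨ , ⟩` and (1.3) (arXiv v2 p. 7) -/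

/-- **`⟨x, y⟩ = tr((x, y)/√Δ)`** (p. 7: «For a hermitian space `V` over `k`, there is an associated alternating form defined by
`⟨x, y⟩ = tr((x, y)/√Δ)`»): for the Gram matrix `J` on `kⁿ` (R0, `(x, y) = krForm σ J x y`, `σ = conj ℚ k`) and `δ = √Δ`, the
`ℚ`-valued pairing `Tr_{k/ℚ}((x, y) δ⁻¹)` (Mathlib `Algebra.trace ℚ k`).  It is `ℚ`-bilinear and, for `J` hermitian, alternating
(`(y, x) = (x, y)^σ`, `δ^σ = −δ`). REAL. [cite: KudlaRapoport2013, §1 Notation and conventions (arXiv v2 p. 7)] -/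
def tracePairing {n : ℕ} (δ : k) (J : Matrix (Fin n) (Fin n) k) (x y : Fin n → k) : ℚ :=
  Algebra.trace ℚ k (krForm (conj ℚ k : k →+* k) J x y / δ)

omit [NumberField k] [IsTotallyComplex k] [Algebra.IsQuadraticExtension ℚ k] in
/-- `krForm` is `k`-linear in the first variable. [folklore] -/
private theorem krForm_smul_left {n : ℕ} (σ : k →+* k) (J : Matrix (Fin n) (Fin n) k) (a : k) (x y : Fin n → k) :
    krForm σ J (a • x) y = a * krForm σ J x y := by
  simp [krForm, Matrix.mulVec_smul, dotProduct_smul, smul_eq_mul]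

omit [NumberField k] [IsTotallyComplex k] [Algebra.IsQuadraticExtension ℚ k] in
/-- `krForm` is `σ`-antilinear in the second variable. [folklore] -/
private theorem krForm_smul_right {n : ℕ} (σ : k →+* k) (J : Matrix (Fin n) (Fin n) k) (b : k) (x y : Fin n → k) :
    krForm σ J x (b • y) = σ b * krForm σ J x y := by
  have h : (⇑σ ∘ (b • y)) = σ b • (⇑σ ∘ y) := by
    funext i
    simp [smul_eq_mul, map_mul]
  simp [krForm, h, smul_dotProduct, smul_eq_mul]

/-- `σ` is an involution: `(a^σ)^σ = a`. [folklore] -/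
private theorem conj_conj (a : k) : conj ℚ k (conj ℚ k a) = a := by
  have hpos : 0 < Fintype.card (k →+* ℂ) := by
    rw [NumberField.Embeddings.card k ℂ]
    exact Module.finrank_pos
  obtain ⟨φ⟩ := Fintype.card_pos_iff.mp hpos
  apply φ.injective
  rw [complexEmbedding_conj, complexEmbedding_conj, starRingEnd_self_apply]

/-- `Tr_{k/ℚ}(z) = z + z^σ` in `k` (the Galois group of the quadratic field `k` is `{1, σ}`). [folklore] -/
private theorem algebraMap_trace_eq (z : k) : algebraMap ℚ k (Algebra.trace ℚ k z) = z + conj ℚ k z := by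
  classical
  rw [trace_eq_sum_automorphisms]
  have hne : conj ℚ k ≠ 1 := conj_ne_one ℚ k
  have hcard : Fintype.card (k ≃ₐ[ℚ] k) = 2 := by
    rw [← Nat.card_eq_fintype_card, IsGalois.card_aut_eq_finrank, Algebra.IsQuadraticExtension.finrank_eq_two]
  have huniv : (Finset.univ : Finset (k ≃ₐ[ℚ] k)) = {1, conj ℚ k} := by
    symm
    apply Finset.eq_univ_of_card
    rw [Finset.card_pair hne.symm, hcard]
  rw [huniv, Finset.sum_pair hne.symm]
  rfl

/-- **«Note that, for `a ∈ k`, `⟨a x, y⟩ = ⟨x, a^σ y⟩`»** (p. 7) — PROVED (squad ruling R-9a): `( , )` is linear in `x`,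
`σ`-antilinear in `y`, and `σ² = 1`. [cite: KudlaRapoport2013, §1 Notation and conventions (arXiv v2 p. 7)] -/
theorem tracePairing_smul_left {n : ℕ} (δ : k) (J : Matrix (Fin n) (Fin n) k) (a : k) (x y : Fin n → k) :
    tracePairing δ J (a • x) y = tracePairing δ J x (conj ℚ k a • y) := by
  unfold tracePairing
  rw [krForm_smul_left, krForm_smul_right]
  simp [conj_conj]

/-- **(1.3) «the hermitian form is given by `2(x, y) = ⟨√Δ x, y⟩ + ⟨x, y⟩ √Δ`»** (p. 7) — PROVED (R-9a), as an identity in `k`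
(`⟨ , ⟩` being `ℚ`-valued, its values are read in `k`), for any `δ ≠ 0` with `δ^σ = −δ` (which `δ = √Δ` satisfies): with
`z = (x, y)`, `⟨δ x, y⟩ = Tr(z) = z + z^σ` and `⟨x, y⟩ δ = (z/δ + z^σ/δ^σ) δ = z − z^σ`. [cite: KudlaRapoport2013, §1 Notation and conventions (1.3) (arXiv v2 p. 7)] -/
theorem two_mul_krForm_eq_tracePairing {n : ℕ} {δ : k} (hδ : δ ≠ 0) (hσ : conj ℚ k δ = -δ)
    (J : Matrix (Fin n) (Fin n) k) (x y : Fin n → k) :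
    2 * krForm (conj ℚ k : k →+* k) J x y =
      algebraMap ℚ k (tracePairing δ J (δ • x) y) + algebraMap ℚ k (tracePairing δ J x y) * δ := by
  unfold tracePairing
  rw [algebraMap_trace_eq, algebraMap_trace_eq, krForm_smul_left]
  have hσ0 : conj ℚ k δ ≠ 0 := by
    rw [hσ]
    exact neg_ne_zero.mpr hδ
  rw [map_div₀, map_div₀, map_mul, hσ]
  field_simp
  ring

/-- **Self-duality for `⟨ , ⟩`**: `L = L^∨_{⟨ , ⟩} := {x ∈ V ∣ ⟨x, L⟩ ⊆ ℤ}` for an `O_k`-submodule `L ⊆ kⁿ` (p. 7: «self-dual for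
`⟨ , ⟩`»), companion of ★ `Sec3ComplexUniformization.IsSelfDualFor` («self-dual for `( , )`»: `L = {x ∣ (x, L) ⊆ O_k}`). REAL.
[cite: KudlaRapoport2013, §1 Notation and conventions (arXiv v2 p. 7)] -/
def IsSelfDualForTrace {n : ℕ} (δ : k) (J : Matrix (Fin n) (Fin n) k) (L : Submodule (𝓞 k) (Fin n → k)) : Prop :=
  ∀ x : Fin n → k, x ∈ L ↔ ∀ y ∈ L, tracePairing δ J x y ∈ (Int.castRingHom ℚ).range

end Literature.AlgebraicGeometry.ShimuraVarieties.KudlaRapoport2013.Sec1NotationConventions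

namespace Literature.AlgebraicGeometry.ShimuraVarieties.KudlaRapoport2013.Sec1NotationConventions

/-- **[KR2013 §1, p. 7] CLOSED**: «An `O_k`-lattice in `V` is self-dual for `( , )` if and only if it is self-dual for `⟨ , ⟩`.»
TYPED in coordinates for every imaginary quadratic `k`, every `δ ∈ k` with `δ² = Δ` (`Δ = NumberField.discr k`, either sign),
every Gram matrix `J` and every `O_k`-submodule `L ⊆ kⁿ`: `IsSelfDualFor σ J L ↔ IsSelfDualForTrace δ J L`.  (True as written,
and slightly more is true: for each `x`, `(x, L) ⊆ O_k ⟺ Tr((x, L)/δ) ⊆ ℤ`, because `(x, a y) = a^σ (x, y)` makes `(x, L)/δ` an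
`O_k`-module, whose traces are integral iff it lies in the inverse different `𝔡_k⁻¹ = δ⁻¹ O_k` — the different of `k = ℚ(√Δ)`
is `(√Δ)`: for `O_k = ℤ[ω]`, `𝔡 = (ω − ω^σ) = (√Δ)` in both cases `Δ ≡ 0, 1 mod 4`.  Hermitian-ness of `J` and fullness of `L` are
not needed.  NOT provable in a few lines from the tree: Mathlib has `differentIdeal` / `FractionalIdeal.dual` but not the value of
the different of a quadratic field.) [cite: KudlaRapoport2013, §1 Notation and conventions (1.3) (arXiv v2 p. 7)] -/
def KR2013_1_selfDual_iff : Prop :=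
  ∀ (k : Type) [Field k] [NumberField k] [IsTotallyComplex k] [Algebra.IsQuadraticExtension ℚ k] (δ : k),
    δ ^ 2 = ((NumberField.discr k : ℤ) : k) →
    ∀ (n : ℕ) (J : Matrix (Fin n) (Fin n) k) (L : Submodule (𝓞 k) (Fin n → k)),
      IsSelfDualFor (conj ℚ k : k →+* k) J L ↔ IsSelfDualForTrace δ J L

end Literature.AlgebraicGeometry.ShimuraVarieties.KudlaRapoport2013.Sec1NotationConventions

end
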